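import Summits.Langlands.Langlands.Theses.EisensteinGelfandKirillov
import Summits.Langlands.Langlands.Theorems.ProModularOrdinaryClassical.Negative.LoadBearing

/-!
# `CrystallineProModularClassical` (stmt-Langlands-18274) — Negative knowledge I: the crux sits
# inside the summit; "HT-regular" as typed is vacuous off the Hodge–Tate locus

From the standing disprover's `Cruxes/CrystallineProModularClassical/Disproof.lean` (cdisprove
gen 1, cycle 1, 2026-08-17). The crux (route EisensteinGelfandKirillov, THE EXIT: pro-modular +
crystalline with distinct labelled Hodge–Tate weights ⇒ classical, `GL₂` over totally real `F`,
`p ≥ 5` unramified) is NOT refuted. This file lands the two checked facts behind that verdict: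

* `satakeConclusion_of_langlands` — for ANY number field `F`, any `n ≥ 1`, any prime `p` and any
  `ρ : Γ_F → GL_n(ℚ̄_p)` irreducible, a.e. unramified and de Rham at every `v ∣ p` for the PINNED
  datum `fontainePstAdicCompletion v p hv`, the summit statement `Langlands` yields an L-algebraic
  cuspidal `π` with Satake–Frobenius matching at almost all places. (The summit's
  `ReciprocityData.pst` is by definition the pinned datum, so the hypotheses are
  `IsGeometricFramed 𝓡 ρ` for every `𝓡`.) Since crystalline ⇒ de Rham
  (`IsCrystallineFramed.isDeRhamFramed`), the crux — and each of its variants with oddness,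
  regularity, pro-modularity, `5 ≤ p`, `p ∤ disc F` or total reality deleted — is a corollary of
  `Langlands`: none of those hypotheses is load-bearing for truth, and any kill of the crux kills
  the summit (`Disproof.lean` §0–§1).
* `nodup_jumpMultiset_of_forall_sub_le_one`, `sub_le_one_of_nodup_jumpMultiset`,
  `jumpMultiset_eq_zero_of_forall_eq`, `isLabelledHodgeTateRegular_of_forall_finrank_succ_eq`,
  `labelledHodgeTateWeights_eq_zero_of_forall_finrank_succ_eq`,
  `isLabelledHodgeTateRegular_of_coeffD_eq_bot`, `hreg_of_coeffD_eq_bot` — the crux's regularity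
  conjunct `IsLabelledHodgeTateRegular 𝔅 ρ = ∀ τ, (HT_τ ρ).Nodup` holds VACUOUSLY for a
  representation without periods (`D_τ = 0`, or any jump-free filtration: `HT_τ = ∅`); with
  finitely many jumps `Nodup` is exactly "every `gr^i D_τ` has dimension `≤ 1`". So regularity
  constrains only representations that already have de Rham periods: in the crux's `hloc` the
  CRYSTALLINE conjunct is the load-bearing half (its deletion is false on paper, `Disproof.lean`
  §1h), the regularity conjunct alone fences nothing.

Mathlib + the route file + the sibling's landed `Negative/LoadBearing`. [folklore]
-/

set_option linter.dupNamespace false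

universe u v v' w

namespace Summit.Langlands.Langlands.Theorems.CrystallineProModularClassical.Negative

open Summit.Langlands.Langlands.Theorems.ProModularOrdinaryClassical.Negative
  (satakeConclusion_of_galoisToAutomorphic)
open Literature.NumberTheory.Automorphic Literature.NumberTheory.GaloisRepresentations
open Literature.NumberTheory.PAdicHodge
open NumberField IsDedekindDomain Filter

/-! ### The crux's conclusion from the summit -/

/-- **The Satake conclusion from `Langlands`, one `ρ` at a time.** For any number field `F`, any
`n ≥ 1`, any prime `p` and any `ρ : Γ_F → GL_n(ℚ̄_p)` that is irreducible, unramified at almost all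
places and de Rham at every `v ∣ p` for the pinned datum `fontainePstAdicCompletion v p hv`, the
summit statement gives an L-algebraic cuspidal `π` on `GL_n(𝔸_F)` with Satake–Frobenius matching at
almost all `v`. Proof: `Langlands F` supplies reciprocity data `𝓡` and conjunct (B); `𝓡.pst p v hv`
is definitionally the pinned datum, so the hypotheses are `IsGeometricFramed 𝓡 ρ`. In particular
`Langlands → CrystallineProModularClassical` (crystalline ⇒ de Rham), and the same holds with
oddness, HT-regularity, pro-modularity, `5 ≤ p`, `p ∤ disc F` and total reality deleted. [folklore] -/
theorem satakeConclusion_of_langlands (hL : _root_.Langlands) {n : ℕ} (hn : 0 < n)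
    {F : Type} [Field F] [NumberField F] {p : ℕ} [Fact p.Prime]
    (hcpt : isCompact_glFiniteIntegralLevel n F) (ι : PadicAlgCl p ≃+* ℂ)
    (ρ : FramedGaloisRep F (PadicAlgCl p) n) (hirr : ρ.toGaloisRep.IsIrreducible)
    (hunr : ∀ᶠ v in cofinite, ρ.IsUnramifiedAt v)
    (hdR : ∀ (v : HeightOneSpectrum (𝓞 F)) (hv : ((p : ℕ) : 𝓞 F) ∈ v.asIdeal),
      (fontainePstAdicCompletion v p hv).IsDeRhamFramed (ρ.toLocal v)) :
    ∃ π : CuspidalAutomorphicRepData n F hcpt, π.1.IsLAlgebraic ∧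
      ∀ᶠ v in cofinite, Summit.Langlands.SatakeFrobCompatibleAt ι π.1 ρ v := by
  obtain ⟨⟨𝓡⟩, h𝓡⟩ := hL F
  exact satakeConclusion_of_galoisToAutomorphic hcpt 𝓡 (h𝓡 𝓡 n hn hcpt).2 ι ρ hirr
    ⟨hunr, fun v hv => hdR v hv⟩

/-- The crystalline form, at the crux's rank: `Langlands` gives the crux's conclusion for every
irreducible a.e.-unramified `ρ : Γ_F → GL₂(ℚ̄_p)` crystalline at all `v ∣ p` for the pinned datum —
no oddness, regularity, pro-modularity or condition on `(F, p)` needed. [folklore] -/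
theorem satakeConclusion_of_langlands_of_isCrystallineFramed (hL : _root_.Langlands)
    {F : Type} [Field F] [NumberField F] {p : ℕ} [Fact p.Prime]
    (hcpt : isCompact_glFiniteIntegralLevel 2 F) (ι : PadicAlgCl p ≃+* ℂ)
    (ρ : FramedGaloisRep F (PadicAlgCl p) 2) (hirr : ρ.toGaloisRep.IsIrreducible)
    (hunr : ∀ᶠ v in cofinite, ρ.IsUnramifiedAt v)
    (hcris : ∀ (v : HeightOneSpectrum (𝓞 F)) (hv : ((p : ℕ) : 𝓞 F) ∈ v.asIdeal),
      (fontainePstAdicCompletion v p hv).IsCrystallineFramed (ρ.toLocal v)) :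
    ∃ π : CuspidalAutomorphicRepData 2 F hcpt, π.1.IsLAlgebraic ∧
      ∀ᶠ v in cofinite, Summit.Langlands.SatakeFrobCompatibleAt ι π.1 ρ v :=
  satakeConclusion_of_langlands hL two_pos hcpt ι ρ hirr hunr fun v hv => (hcris v hv).isDeRhamFramed

/-! ### "Labelled-HT-regular" as typed: `Nodup` of a jump multiset -/

/-- A jump multiset is multiplicity-free as soon as every jump has height `≤ 1` (and, by the junk
value `0`, whenever the set of jumps is infinite). [folklore] -/
theorem nodup_jumpMultiset_of_forall_sub_le_one {d : ℤ → ℕ} (h : ∀ i, d i - d (i + 1) ≤ 1) :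
    (jumpMultiset d).Nodup := by
  by_cases hf : {i : ℤ | d (i + 1) < d i}.Finite
  · rw [Multiset.nodup_iff_count_le_one]
    intro i
    rw [count_jumpMultiset hf]
    exact h i
  · rw [jumpMultiset_of_not_finite hf]
    exact Multiset.nodup_zero

/-- Conversely, with finitely many jumps, multiplicity-free means every jump has height `≤ 1`
(for the `D_dR` of a de Rham rank-`n` representation: all `gr^i D_τ` have dimension `≤ 1`, i.e.
`n` distinct `τ`-weights — the intended meaning of the crux's hypothesis). [folklore] -/
theorem sub_le_one_of_nodup_jumpMultiset {d : ℤ → ℕ} (hf : {i : ℤ | d (i + 1) < d i}.Finite)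
    (h : (jumpMultiset d).Nodup) (i : ℤ) : d i - d (i + 1) ≤ 1 := by
  rw [← count_jumpMultiset hf]
  exact Multiset.nodup_iff_count_le_one.1 h i

/-- A function without jumps has EMPTY jump multiset. [folklore] -/
theorem jumpMultiset_eq_zero_of_forall_eq {d : ℤ → ℕ} (h : ∀ i, d (i + 1) = d i) :
    jumpMultiset d = 0 := by
  have hf : {i : ℤ | d (i + 1) < d i} = ∅ := Set.eq_empty_of_forall_notMem fun i hi => by
    simp only [Set.mem_setOf_eq, h i, lt_self_iff_false] at hi
  rw [jumpMultiset_of_finite (by rw [hf]; exact Set.finite_empty)]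
  refine Finset.sum_eq_zero fun i _ => ?_
  rw [h i, Nat.sub_self, Multiset.replicate_zero]

section PeriodRing

variable {Γ : Type u} [Group Γ] [TopologicalSpace Γ] {P : Type v} {K : Type v'} [Field P]
  [Field K] [Algebra P K]
  {E : Type*} [Field E] [Algebra P E] [TopologicalSpace E]
  {M : Type*} [AddCommGroup M] [Module E M] [Module P M] [IsScalarTower P E M]
  [TopologicalSpace M]
  (𝔅 : PeriodRingData.{u, v, v', w} Γ P K) (r : ContinuousRep Γ E M)

/-- **"Labelled-HT-regular" as typed is VACUOUS off the Hodge–Tate locus.** If for every label `τ`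
the filtration of `D_τ` has no jumps (e.g. `D_τ = 0`), then every `HT_τ(r)` is EMPTY, hence
`Nodup`, and `r` is `IsLabelledHodgeTateRegular` although it has no Hodge–Tate weights at all.
[folklore] -/
theorem isLabelledHodgeTateRegular_of_forall_finrank_succ_eq
    (h : ∀ (τ : K →ₐ[P] E) (i : ℤ), Module.finrank E (𝔅.labelFilD r τ.toRingHom (i + 1)) =
      Module.finrank E (𝔅.labelFilD r τ.toRingHom i)) :
    𝔅.IsLabelledHodgeTateRegular r := fun τ => by
  rw [PeriodRingData.labelledHodgeTateWeights_def, jumpMultiset_eq_zero_of_forall_eq (h τ)]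
  exact Multiset.nodup_zero

/-- In that situation every labelled weight multiset is empty. [folklore] -/
theorem labelledHodgeTateWeights_eq_zero_of_forall_finrank_succ_eq (τ : K →+* E)
    (h : ∀ i : ℤ, Module.finrank E (𝔅.labelFilD r τ (i + 1)) =
      Module.finrank E (𝔅.labelFilD r τ i)) :
    𝔅.labelledHodgeTateWeights r τ = 0 := by
  rw [PeriodRingData.labelledHodgeTateWeights_def, jumpMultiset_eq_zero_of_forall_eq h]

/-- **No periods ⇒ "regular".** If `D(r) = (M ⊗ B)^Γ = 0` (no invariant tensor at all: the extreme
non-de-Rham case), then `r` is labelled-Hodge–Tate-regular as typed. [folklore] -/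
theorem isLabelledHodgeTateRegular_of_coeffD_eq_bot (h : 𝔅.coeffD r = ⊥) :
    𝔅.IsLabelledHodgeTateRegular r := by
  refine isLabelledHodgeTateRegular_of_forall_finrank_succ_eq 𝔅 r fun τ i => ?_
  have hD : ∀ j, 𝔅.labelFilD r τ.toRingHom j = ⊥ := fun j =>
    eq_bot_iff.2 (((𝔅.labelFilD_le r _ j).trans (𝔅.labelD_le_coeffD r _)).trans h.le)
  rw [hD, hD]

end PeriodRing

/-- **At the crux's types**: a `ρ : Γ_F → GL₂(ℚ̄_p)` whose restriction to `Γ_{F_v}`, `v ∣ p`, has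
NO `B_dR`-periods for the pinned datum (`D = 0`) satisfies the regularity conjunct of
`CrystallineProModularClassical` at `v`. So that conjunct never excludes a non-Hodge–Tate witness
(e.g. a cyclotomic twist `ρ_f ⊗ ⟨ε⟩^t`, `2t ∉ ℤ`); only the crystalline conjunct does. [folklore] -/
theorem hreg_of_coeffD_eq_bot {F : Type} [Field F] [NumberField F] {p : ℕ} [Fact p.Prime]
    (ρ : FramedGaloisRep F (PadicAlgCl p) 2) (v : HeightOneSpectrum (𝓞 F))
    (hv : ((p : ℕ) : 𝓞 F) ∈ v.asIdeal)
    (h : letI := (fontainePstAdicCompletion v p hv).algebra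
      (fontainePstAdicCompletion v p hv).𝔅.coeffD
        ((ρ.toLocal v).toGaloisRep : ContinuousRep _ (PadicAlgCl p) (Fin 2 → PadicAlgCl p)) = ⊥) :
    letI := (fontainePstAdicCompletion v p hv).algebra
    GaloisRep.IsLabelledHodgeTateRegular (fontainePstAdicCompletion v p hv).𝔅
      (ρ.toLocal v).toGaloisRep := by
  letI := (fontainePstAdicCompletion v p hv).algebra
  exact isLabelledHodgeTateRegular_of_coeffD_eq_bot _ _ h

end Summit.Langlands.Langlands.Theorems.CrystallineProModularClassical.Negative
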